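import Summits.AtomisticToContinuum.Crystallization.Theorems.FrustratedLawDichotomyFiniteClusterGapPrelude
import Summits.AtomisticToContinuum.Crystallization.Theorems.FrustratedLawDichotomyTextureFineShells
import Summits.AtomisticToContinuum.Crystallization.Theorems.FrustratedLawDichotomyThinning
import Literature.Probability.Process.RootedHardCoreConfig

/-!
# FrustratedLawDichotomy · crux `AperiodicFrustratedLawGap` (stmt-AtomisticToContinuum-27623) — PALM FREQUENCIES FROM UBIQUITY
# (decomp-a2c, prover hand 1, direct share, generation 6)

The texture clause (d) of the crux is QUALITATIVE and pointwise («within `R₈` of EVERY atom there is a `1/8`-good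
site», …).  Every closing argument of the shape «local price × frequency ≥ gap» needs it as a NUMBER at the law level:
a lower bound on the Palm probability that the ROOT itself is such a site.  This file supplies the conversion, by mass
transport, and applies it to the fine shells of hand 1's texture transfer (`FrustratedLawDichotomyTextureFineShells`).

* §1 `count_closedBall_le` — packing: a rooted `δ`-hard-core configuration has at most `C(δ, R)` atoms in the closed
  `R`-ball about the root.
* §2 **`measure_univ_le_mul_of_ubiquitous` — UBIQUITY ⟹ POSITIVE PALM FREQUENCY.**  Let `P` be point-stationary and
  almost surely rooted `δ`-hard-core, and `A` a measurable set of configurations which is `R`-UBIQUITOUS: almost surely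
  some atom `x` with `‖x‖ ≤ R` has its re-rooted configuration `θ_x μ = μ.map (· − x)` in `A`.  Then
  `P(univ) ≤ C(δ, R) · P(A)`; for a probability law, `P(A) ≥ 1 / C(δ, R)` (`inv_le_prob_of_ubiquitous`).  Mass transport:
  every atom sends unit mass, split evenly, to the `A`-atoms within `R` of it; out-flow `= 1` a.s., in-flow at the root
  `≤ 1[μ ∈ A] · #(atoms within R) ≤ C · 1[μ ∈ A]`; the Mecke identity compares the two.  (The point-process form of
  «a property seen within bounded distance of every vertex of a unimodular network has positive root frequency»,
  Aldous–Lyons 2007 §2; companion of hand 1's `ae_not_finite_nonempty_selection`.)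
* §3 `measure_univ_le_mul_fineRootHull_of_texture` — APPLICATION: under clauses (a) + (d) of the crux (only separation,
  clause (4) and the two matching clauses, in the reduced form consumed by `fineShell_of_texture`) and «a second atom»
  (automatic for texture-charged laws, `FrustratedLawDichotomyTextureToolkit.nontrivial_of_texture`), every measurable
  set `A` containing all configurations whose ROOT carries a two-sided `(1/8 + ε)`-fcc/hcp shell (the conclusion of
  `fineShell_of_texture`, re-rooted) has `P(univ) ≤ C(δ, R₈ + ε) · P(A)`: the OUTER Palm frequency of fine-shelled roots is
  at least `1 / C(δ, R₈ + ε)`.  (Stated for measurable hulls because goodness of the root's shell is not asserted to be a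
  measurable event here; every measurable consequence of it inherits the bound.)

All `[folklore]` (mass-transport principle; Aldous–Lyons 2007 §2, Last–Penrose 2017 §9.5 for the Mecke form).  No
definitions, no `sorry`.
-/

noncomputable section

namespace Summit.AtomisticToContinuum.Crystallization.Theorems.FrustratedLawDichotomyPalmFrequency

open MeasureTheory Metric Set Filter ProbabilityTheory
open scoped ENNReal
open Literature.Probability.Process
open Summit.AtomisticToContinuum.Crystallization.Theorems.ChargedEnergyGapNegative (E3)
open Summit.AtomisticToContinuum.Crystallization.Theorems.FrustratedLawDichotomyFiniteClusterGap
  (exists_kernel_eq_count_restrict measurable_kernel_map_sub ae_mem_of_sep)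
open Summit.AtomisticToContinuum.Crystallization.Theorems.FrustratedLawDichotomyTextureFineShells (fineShell_of_texture)
open Literature.Probability.Process.LocalConfig (exists_forall_encard_inter_le)
open Summit.AtomisticToContinuum.Crystallization.Theorems.FrustratedLawDichotomyThinning (map_sub_map_sub_neg)

/-! ## §1. Packing in the root's ball -/

section Packing

variable {δ : ℝ}

/-- **Packing bound at the root.**  For `δ > 0` and a radius `R` there is `C : ℕ` with `μ(closed R-ball about 0) ≤ C` for every
rooted `δ`-hard-core configuration `μ` (a `δ`-separated set meets a compact set in uniformly finitely many points,
`exists_forall_encard_inter_le`). [folklore] -/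
theorem count_closedBall_le (hδ : 0 < δ) (R : ℝ) :
    ∃ C : ℕ, ∀ μ : Measure E3, IsRootedHardCore δ μ → μ (closedBall (0 : E3) R) ≤ C := by
  obtain ⟨C₀, hC₀⟩ := exists_forall_encard_inter_le (E := E3) hδ (isCompact_closedBall (0 : E3) R)
  refine ⟨C₀, fun μ hμ => ?_⟩
  obtain ⟨S, -, hsep, rfl⟩ := hμ
  have hfin : (closedBall (0 : E3) R ∩ S).Finite := finite_of_encard_le_coe (hC₀ S hsep)
  rw [Measure.restrict_apply measurableSet_closedBall, Measure.count_apply_finite _ hfin]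
  have h := hC₀ S hsep
  rw [hfin.encard_eq_coe_toFinset_card, Nat.cast_le] at h
  exact_mod_cast h

/-- An atom of a rooted hard-core configuration has unit mass: `μ {x} ≠ 0 → 1 ≤ μ {x}` for `μ = count|S`. [folklore] -/
theorem one_le_apply_singleton_of_ne_zero {μ : Measure E3} (hμ : IsRootedHardCore δ μ) {x : E3} (hx : μ {x} ≠ 0) :
    1 ≤ μ {x} := by
  obtain ⟨S, -, -, rfl⟩ := hμ
  have hxS : x ∈ S := (count_restrict_singleton_ne_zero_iff S x).1 hx
  rw [Measure.restrict_apply (measurableSet_singleton x), Set.singleton_inter_of_mem hxS,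
    Measure.count_singleton]

end Packing

/-! ## §2. Ubiquity ⟹ positive Palm frequency (mass transport) -/

section Ubiquity

variable {δ : ℝ}

/-- **UBIQUITY ⟹ POSITIVE PALM FREQUENCY.**  For `δ > 0` and a radius `R` there is `C : ℕ` (the packing bound of
`count_closedBall_le`) such that for every point-stationary law `P` almost surely carried by rooted `δ`-hard-core
configurations and every measurable `A` which is `R`-ubiquitous — a.s. some atom `x` with `‖x‖ ≤ R` has `θ_x μ ∈ A` — one has
`P univ ≤ C · P A`.  Mass transport «unit mass from every atom, split evenly among the `A`-atoms within `R`»: out-flow `1` a.s.,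
in-flow at the root `≤ C · 1[μ ∈ A]`, and the Mecke identity. [folklore] -/
theorem measure_univ_le_mul_of_ubiquitous (hδ : 0 < δ) (R : ℝ) :
    ∃ C : ℕ, ∀ P : Measure (Measure E3), (∀ᵐ μ ∂P, IsRootedHardCore δ μ) → IsPointStationaryLaw P →
      ∀ A : Set (Measure E3), MeasurableSet A →
        (∀ᵐ μ ∂P, ∃ x : E3, μ {x} ≠ 0 ∧ ‖x‖ ≤ R ∧ μ.map (fun z : E3 => z - x) ∈ A) →
        P univ ≤ C * P A := by
  classical
  obtain ⟨C, hC⟩ := count_closedBall_le hδ R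
  obtain ⟨κ, hκs, hκS⟩ := exists_kernel_eq_count_restrict hδ
  have hκ : ∀ μ : Measure E3, IsRootedHardCore δ μ → κ μ = μ := by
    rintro μ ⟨S, -, hsep, rfl⟩; exact hκS S hsep
  refine ⟨C, fun P hcore hstat A hA hub => ?_⟩
  -- the selection `Sel = {(μ, z) : ‖z‖ ≤ R, θ_z (κ μ) ∈ A}` (through the kernel, for joint measurability)
  set Sel : Set (Measure E3 × E3) := {q | ‖q.2‖ ≤ R ∧ (κ q.1).map (fun z : E3 => z - q.2) ∈ A} with hSel
  have hSelm : MeasurableSet Sel :=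
    (measurableSet_le measurable_snd.norm measurable_const).inter ((measurable_kernel_map_sub κ) hA)
  set χ : Measure E3 × E3 → ℝ≥0∞ := Sel.indicator 1 with hχ
  have hχm : Measurable χ := measurable_one.indicator hSelm
  have hχμ : ∀ μ : Measure E3, (fun z => χ (μ, z)) = (Prod.mk μ ⁻¹' Sel).indicator 1 := fun μ => by
    funext z; by_cases h : (μ, z) ∈ Sel <;> simp [hχ, h]
  -- the number of selected atoms
  set N : Measure E3 → ℝ≥0∞ := fun μ => κ μ (Prod.mk μ ⁻¹' Sel) with hN
  have hNm : Measurable N := Kernel.measurable_kernel_prodMk_left hSelm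
  have hNμ : ∀ μ : Measure E3, IsRootedHardCore δ μ → N μ = μ (Prod.mk μ ⁻¹' Sel) := fun μ hμ => by
    simp only [hN, hκ μ hμ]
  -- on hard-core configurations the section of `Sel` is `{z : ‖z‖ ≤ R, θ_z μ ∈ A}`, inside the closed `R`-ball
  have hsec : ∀ μ : Measure E3, IsRootedHardCore δ μ → ∀ z : E3,
      (μ, z) ∈ Sel ↔ ‖z‖ ≤ R ∧ μ.map (fun w : E3 => w - z) ∈ A := fun μ hμ z => by
    simp only [hSel, mem_setOf_eq, hκ μ hμ]
  have hsub : ∀ μ : Measure E3, IsRootedHardCore δ μ → Prod.mk μ ⁻¹' Sel ⊆ closedBall (0 : E3) R := fun μ hμ z hz => by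
    rw [mem_closedBall, dist_zero_right]
    exact ((hsec μ hμ z).1 hz).1
  have hNle : ∀ μ : Measure E3, IsRootedHardCore δ μ → N μ ≤ C := fun μ hμ => by
    rw [hNμ μ hμ]
    exact (measure_mono (hsub μ hμ)).trans (hC μ hμ)
  -- the transport `g(μ, z) = χ(μ, z) / max 1 (N μ)`
  set g : Measure E3 → E3 → ℝ≥0∞ := fun μ z => χ (μ, z) * (max 1 (N μ))⁻¹ with hg
  have hgm : Measurable (Function.uncurry g) :=
    hχm.mul (((measurable_const.max hNm).comp measurable_fst).inv)
  have key := hstat g hgm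
  -- out-flow: `1` almost surely (ubiquity gives `N μ ≥ 1`, packing gives `N μ ≤ C < ∞`)
  have hout : ∀ᵐ μ ∂P, ∫⁻ z, g μ z ∂μ = 1 := by
    filter_upwards [hcore, hub] with μ hμ hubμ
    obtain ⟨x, hx, hxR, hxA⟩ := hubμ
    have hmz : Measurable fun z : E3 => χ (μ, z) := hχm.comp measurable_prodMk_left
    have h1 : ∫⁻ z, g μ z ∂μ = N μ * (max 1 (N μ))⁻¹ := by
      simp only [hg]
      rw [lintegral_mul_const _ hmz, hχμ μ,
        lintegral_indicator_one (show MeasurableSet (Prod.mk μ ⁻¹' Sel) from measurable_prodMk_left hSelm), ← hNμ μ hμ]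
    have hN1 : 1 ≤ N μ := by
      rw [hNμ μ hμ]
      have hxSel : x ∈ Prod.mk μ ⁻¹' Sel := (hsec μ hμ x).2 ⟨hxR, hxA⟩
      exact (one_le_apply_singleton_of_ne_zero hμ hx).trans (measure_mono (singleton_subset_iff.2 hxSel))
    have hNtop : N μ ≠ ∞ := ne_top_of_le_ne_top (ENNReal.natCast_ne_top C) (hNle μ hμ)
    rw [h1, max_eq_right hN1, ENNReal.mul_inv_cancel (ne_of_gt (lt_of_lt_of_le zero_lt_one hN1)) hNtop]
  -- in-flow at the root: `≤ C · 1[μ ∈ A]` almost surely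
  have hin : ∀ᵐ μ ∂P, ∫⁻ y, g (μ.map fun z : E3 => z - y) (-y) ∂μ ≤ A.indicator (fun _ => (C : ℝ≥0∞)) μ := by
    filter_upwards [hcore] with μ hμ
    have hμ' := hμ
    obtain ⟨S, h0, hsep, rfl⟩ := hμ
    -- pointwise bound at every atom `y`
    have hpt : ∀ᵐ y ∂((Measure.count : Measure E3).restrict S),
        g (((Measure.count : Measure E3).restrict S).map fun z : E3 => z - y) (-y) ≤
          (closedBall (0 : E3) R).indicator 1 y *
            A.indicator 1 ((Measure.count : Measure E3).restrict S) := by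
      refine (ae_mem_of_sep hδ hsep).mono fun y hy => ?_
      have hy' : (Measure.count : Measure E3).restrict S {y} ≠ 0 := (count_restrict_singleton_ne_zero_iff S y).2 hy
      have hθ : IsRootedHardCore δ (((Measure.count : Measure E3).restrict S).map fun z : E3 => z - y) := hμ'.map_sub hy'
      simp only [hg]
      refine (mul_le_of_le_one_right' (ENNReal.inv_le_one.2 (le_max_left _ _))).trans ?_
      simp only [hχ]
      by_cases hm : ((((Measure.count : Measure E3).restrict S).map fun z : E3 => z - y), -y) ∈ Sel
      · have hm' := (hsec _ hθ (-y)).1 hm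
        rw [norm_neg] at hm'
        rw [map_sub_map_sub_neg] at hm'
        rw [indicator_of_mem hm, indicator_of_mem (mem_closedBall_zero_iff.2 hm'.1), indicator_of_mem hm'.2]
        simp
      · rw [indicator_of_notMem hm]
        exact bot_le
    have hmono := lintegral_mono_ae hpt
    refine hmono.trans ?_
    rw [lintegral_mul_const _ (measurable_one.indicator measurableSet_closedBall),
      lintegral_indicator_one measurableSet_closedBall]
    by_cases hA' : (Measure.count : Measure E3).restrict S ∈ A
    · rw [indicator_of_mem hA', indicator_of_mem hA', Pi.one_apply, mul_one]
      exact hC _ hμ'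
    · rw [indicator_of_notMem hA', indicator_of_notMem hA', mul_zero]
  -- the Mecke identity
  have hL : ∫⁻ μ, ∫⁻ z, g μ z ∂μ ∂P = P univ := by
    rw [lintegral_congr_ae hout, lintegral_one]
  have hR : ∫⁻ μ, ∫⁻ y, g (μ.map fun z : E3 => z - y) (-y) ∂μ ∂P ≤ C * P A :=
    (lintegral_mono_ae hin).trans (by rw [lintegral_indicator_const hA])
  calc P univ = ∫⁻ μ, ∫⁻ z, g μ z ∂μ ∂P := hL.symm
    _ = ∫⁻ μ, ∫⁻ y, g (μ.map fun z : E3 => z - y) (-y) ∂μ ∂P := key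
    _ ≤ C * P A := hR

/-- **Probability form.**  Under the hypotheses of `measure_univ_le_mul_of_ubiquitous`, a point-stationary PROBABILITY law gives
every `R`-ubiquitous measurable `A` Palm probability `P A ≥ 1 / C(δ, R)`. [folklore] -/
theorem inv_le_prob_of_ubiquitous (hδ : 0 < δ) (R : ℝ) :
    ∃ C : ℕ, ∀ P : Measure (Measure E3), IsProbabilityMeasure P → (∀ᵐ μ ∂P, IsRootedHardCore δ μ) →
      IsPointStationaryLaw P → ∀ A : Set (Measure E3), MeasurableSet A →
        (∀ᵐ μ ∂P, ∃ x : E3, μ {x} ≠ 0 ∧ ‖x‖ ≤ R ∧ μ.map (fun z : E3 => z - x) ∈ A) →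
        (C : ℝ≥0∞)⁻¹ ≤ P A := by
  obtain ⟨C, hC⟩ := measure_univ_le_mul_of_ubiquitous hδ R
  refine ⟨C, fun P hP hcore hstat A hA hub => ?_⟩
  have h := hC P hcore hstat A hA hub
  rw [measure_univ] at h
  rw [← one_div]
  exact ENNReal.div_le_of_le_mul (by rwa [mul_comm] at h)

end Ubiquity

/-! ## §3. Application: the Palm frequency of fine-shelled roots under the texture clause -/

section FineShells

variable {δ : ℝ}

/-- Atoms of the re-rooted configuration: `(θ_x μ) {s} ≠ 0 ↔ μ {s + x} ≠ 0`. [folklore] -/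
theorem map_sub_apply_singleton (μ : Measure E3) (x s : E3) :
    (μ.map fun z : E3 => z - x) {s} = μ {s + x} := by
  rw [Measure.map_apply (measurable_sub_const x) (measurableSet_singleton s)]
  congr 1
  ext z
  simp [sub_eq_iff_eq_add]

/-- **Re-rooting a fine shell.**  If the atom `p'` of `μ` carries a two-sided `(1/8 + ε)`-fcc/hcp shell at scale `d` (the conclusion of
`fineShell_of_texture`, stated with the atoms of `μ` around `p'`), then the ROOT of `θ_{p'} μ` carries the same shell (stated with the
atoms of `θ_{p'} μ` around `0`). [folklore] -/
theorem fineRoot_of_fineShell {μ : Measure E3} {p' : E3} {ε d : ℝ}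
    (hnn : ∀ s : E3, μ {s} ≠ 0 → s ≠ p' → d ≤ dist s p' + ε)
    {A : E3 →ₗᵢ[ℝ] E3}
    (hsh : ((∀ u ∈ Literature.Geometry.DiscreteGeometry.fccKissingPattern, ∃ s : E3, μ {s} ≠ 0 ∧ dist (s - p') (d • A u) ≤ d / 8 + ε) ∧
          (∀ s : E3, μ {s} ≠ 0 → s ≠ p' → dist s p' + ε ≤ 13 / 10 * d →
            ∃ u ∈ Literature.Geometry.DiscreteGeometry.fccKissingPattern, dist (s - p') (d • A u) ≤ d / 8 + ε)) ∨
        ((∀ u ∈ Literature.Geometry.DiscreteGeometry.hcpKissingPattern, ∃ s : E3, μ {s} ≠ 0 ∧ dist (s - p') (d • A u) ≤ d / 8 + ε) ∧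
          (∀ s : E3, μ {s} ≠ 0 → s ≠ p' → dist s p' + ε ≤ 13 / 10 * d →
            ∃ u ∈ Literature.Geometry.DiscreteGeometry.hcpKissingPattern, dist (s - p') (d • A u) ≤ d / 8 + ε))) :
    (∀ s : E3, (μ.map fun z : E3 => z - p') {s} ≠ 0 → s ≠ 0 → d ≤ ‖s‖ + ε) ∧
      (((∀ u ∈ Literature.Geometry.DiscreteGeometry.fccKissingPattern, ∃ s : E3, (μ.map fun z : E3 => z - p') {s} ≠ 0 ∧ dist s (d • A u) ≤ d / 8 + ε) ∧
          (∀ s : E3, (μ.map fun z : E3 => z - p') {s} ≠ 0 → s ≠ 0 → ‖s‖ + ε ≤ 13 / 10 * d →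
            ∃ u ∈ Literature.Geometry.DiscreteGeometry.fccKissingPattern, dist s (d • A u) ≤ d / 8 + ε)) ∨
        ((∀ u ∈ Literature.Geometry.DiscreteGeometry.hcpKissingPattern, ∃ s : E3, (μ.map fun z : E3 => z - p') {s} ≠ 0 ∧ dist s (d • A u) ≤ d / 8 + ε) ∧
          (∀ s : E3, (μ.map fun z : E3 => z - p') {s} ≠ 0 → s ≠ 0 → ‖s‖ + ε ≤ 13 / 10 * d →
            ∃ u ∈ Literature.Geometry.DiscreteGeometry.hcpKissingPattern, dist s (d • A u) ≤ d / 8 + ε))) := by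
  have hat : ∀ s : E3, (μ.map fun z : E3 => z - p') {s} ≠ 0 ↔ μ {s + p'} ≠ 0 := fun s => by
    rw [map_sub_apply_singleton]
  have hne : ∀ s : E3, s ≠ 0 ↔ s + p' ≠ p' := fun s => by
    constructor
    · intro h h'; exact h (by simpa using h')
    · intro h h'; exact h (by simp [h'])
  have hdist : ∀ s : E3, dist (s + p') p' = ‖s‖ := fun s => by
    rw [dist_eq_norm, add_sub_cancel_right]
  have hsub : ∀ s : E3, s + p' - p' = s := fun s => add_sub_cancel_right s p'
  refine ⟨fun s hs hs0 => ?_, ?_⟩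
  · have := hnn (s + p') ((hat s).1 hs) ((hne s).1 hs0)
    rwa [hdist] at this
  rcases hsh with ⟨hone, htwo⟩ | ⟨hone, htwo⟩
  · refine Or.inl ⟨fun u hu => ?_, fun s hs hs0 hle => ?_⟩
    · obtain ⟨s, hs, h⟩ := hone u hu
      refine ⟨s - p', ?_, h⟩
      rw [hat, sub_add_cancel]; exact hs
    · have h := htwo (s + p') ((hat s).1 hs) ((hne s).1 hs0) (by rw [hdist]; exact hle)
      rwa [hsub] at h
  · refine Or.inr ⟨fun u hu => ?_, fun s hs hs0 hle => ?_⟩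
    · obtain ⟨s, hs, h⟩ := hone u hu
      refine ⟨s - p', ?_, h⟩
      rw [hat, sub_add_cancel]; exact hs
    · have h := htwo (s + p') ((hat s).1 hs) ((hne s).1 hs0) (by rw [hdist]; exact hle)
      rwa [hsub] at h

/-- **PALM FREQUENCY OF FINE-SHELLED ROOTS.**  For `δ > 0`, a fine radius `R₈` and a slack `ε > 0` there is `C : ℕ` (the packing
bound at radius `R₈ + ε`) such that: for every point-stationary law `P` almost surely carried by rooted `δ`-hard-core configurations with
a second atom, which are texture-charged in the reduced sense consumed by `fineShell_of_texture` (separation of the approximants,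
clause (4) «a `1/8`-good site within `R₈` of every site of the ball», two-way matching — all implied by clause (d) of the crux),
and for every MEASURABLE set `A` of configurations containing every configuration whose ROOT carries a two-sided `(1/8 + ε)`-fcc/hcp
shell at a nearest-neighbour scale `d ≥ 7/10`, one has `P univ ≤ C · P A` — for a probability law, `P A ≥ 1/C`.  Proof: fine shells are
`(R₈ + ε)`-ubiquitous (`fineShell_of_texture` at the root) and `measure_univ_le_mul_of_ubiquitous`. [folklore] -/
theorem measure_univ_le_mul_fineRootHull_of_texture (hδ : 0 < δ) (R₈ ε : ℝ) (hε : 0 < ε) :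
    ∃ C : ℕ, ∀ P : Measure (Measure E3), (∀ᵐ μ ∂P, IsRootedHardCore δ μ) → IsPointStationaryLaw P →
      (∀ᵐ μ ∂P, ∃ p₂ : E3, μ {p₂} ≠ 0 ∧ p₂ ≠ 0) →
      (∀ᵐ μ ∂P, ∀ q : E3, μ {q} ≠ 0 → ∀ R ε' : ℝ, 0 < ε' → ∃ (N : ℕ) (y : Fin N → E3) (i : Fin N),
        (∀ a b : Fin N, a ≠ b → (7 : ℝ) / 10 ≤ dist (y a) (y b)) ∧
        (∀ j : Fin N, dist (y j) (y i) ≤ R → ∃ k : Fin N, dist (y k) (y j) ≤ R₈ ∧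
          ∃ A : E3 →ₗᵢ[ℝ] E3,
            (∃ e : ↥{z : E3 | z ∈ Set.range y ∧ z ≠ y k ∧ dist z (y k) < 13 / 10 * sInf ((fun z => dist z (y k)) '' (Set.range y \ {y k}))} ≃ ↥Literature.Geometry.DiscreteGeometry.fccKissingPattern, ∀ t : ↥{z : E3 | z ∈ Set.range y ∧ z ≠ y k ∧ dist z (y k) < 13 / 10 * sInf ((fun z => dist z (y k)) '' (Set.range y \ {y k}))}, dist ((sInf ((fun z => dist z (y k)) '' (Set.range y \ {y k})))⁻¹ • ((t : E3) - y k)) (A ((e t : ↥Literature.Geometry.DiscreteGeometry.fccKissingPattern) : E3)) ≤ 1 / 8) ∨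
            (∃ e : ↥{z : E3 | z ∈ Set.range y ∧ z ≠ y k ∧ dist z (y k) < 13 / 10 * sInf ((fun z => dist z (y k)) '' (Set.range y \ {y k}))} ≃ ↥Literature.Geometry.DiscreteGeometry.hcpKissingPattern, ∀ t : ↥{z : E3 | z ∈ Set.range y ∧ z ≠ y k ∧ dist z (y k) < 13 / 10 * sInf ((fun z => dist z (y k)) '' (Set.range y \ {y k}))}, dist ((sInf ((fun z => dist z (y k)) '' (Set.range y \ {y k})))⁻¹ • ((t : E3) - y k)) (A ((e t : ↥Literature.Geometry.DiscreteGeometry.hcpKissingPattern) : E3)) ≤ 1 / 8)) ∧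
        (∀ s : E3, μ {s} ≠ 0 → dist s q ≤ R → ∃ a : Fin N, dist (y a - y i) (s - q) ≤ ε') ∧
        (∀ a : Fin N, dist (y a) (y i) ≤ R → ∃ s : E3, μ {s} ≠ 0 ∧ dist (y a - y i) (s - q) ≤ ε')) →
      ∀ A : Set (Measure E3), MeasurableSet A →
        (∀ ν : Measure E3, (∃ d : ℝ, (7 : ℝ) / 10 ≤ d ∧ (∀ s : E3, ν {s} ≠ 0 → s ≠ 0 → d ≤ ‖s‖ + ε) ∧
            ∃ A : E3 →ₗᵢ[ℝ] E3,
              ((∀ u ∈ Literature.Geometry.DiscreteGeometry.fccKissingPattern, ∃ s : E3, ν {s} ≠ 0 ∧ dist s (d • A u) ≤ d / 8 + ε) ∧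
                (∀ s : E3, ν {s} ≠ 0 → s ≠ 0 → ‖s‖ + ε ≤ 13 / 10 * d →
                  ∃ u ∈ Literature.Geometry.DiscreteGeometry.fccKissingPattern, dist s (d • A u) ≤ d / 8 + ε)) ∨
              ((∀ u ∈ Literature.Geometry.DiscreteGeometry.hcpKissingPattern, ∃ s : E3, ν {s} ≠ 0 ∧ dist s (d • A u) ≤ d / 8 + ε) ∧
                (∀ s : E3, ν {s} ≠ 0 → s ≠ 0 → ‖s‖ + ε ≤ 13 / 10 * d →
                  ∃ u ∈ Literature.Geometry.DiscreteGeometry.hcpKissingPattern, dist s (d • A u) ≤ d / 8 + ε))) → ν ∈ A) →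
        P univ ≤ C * P A := by
  obtain ⟨C, hC⟩ := measure_univ_le_mul_of_ubiquitous hδ (R₈ + ε)
  refine ⟨C, fun P hcore hstat htwo htex A hA hhull => hC P hcore hstat A hA ?_⟩
  filter_upwards [hcore, htwo, htex] with μ hμ hμ2 h
  obtain ⟨p₂, hp₂, hp₂0⟩ := hμ2
  have h0 : μ {0} ≠ 0 := by
    obtain ⟨S, h0S, -, rfl⟩ := hμ
    exact (count_restrict_singleton_ne_zero_iff S 0).2 h0S
  obtain ⟨p', hp', hp'R, d, hd7, hnn, A', hsh⟩ := fineShell_of_texture hδ hμ (R₈ := R₈) h h0 hp₂ hp₂0 hε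
  refine ⟨p', hp', by rwa [← dist_zero_right], hhull _ ⟨d, hd7, ?_⟩⟩
  obtain ⟨hnn', hsh'⟩ := fineRoot_of_fineShell (μ := μ) (p' := p') (ε := ε) (d := d) hnn (A := A') hsh
  exact ⟨hnn', A', hsh'⟩

end FineShells

end Summit.AtomisticToContinuum.Crystallization.Theorems.FrustratedLawDichotomyPalmFrequency

end
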